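import Literature.Geometry.Lorentzian.CoordCurvatureRicciIdentity
import HarnessLib

/-!
# The Laplacian of the curvature tensor in coordinates (Topping 2006, Prop. 2.4.1)

Sixth layer of the coordinate tensor calculus (`CoordCurvature`, `CoordBianchi`,
`CoordMetricVariation`, `CoordScalarCurvatureEvolution`, `CoordCurvatureRicciIdentity`): metric
components `G : E → (E →L E →L ℝ)`, smooth, symmetric and nondegenerate on an open set `V`
(`IsMetricOn G V`); basis `b` of `E` with inverse metric coefficients `g^{kl} = ginv G b x k l`.
We prove, by Fréchet calculus on constant fields:

* `IsMetricOn.fderiv_ginv` — `∂_X g^{kl} = −g^{kc} (∂_X G)(b_c,b_d) g^{dl}`;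
* `IsMetricOn.sum_fderiv_ginv_smul`, **`IsMetricOn.fderiv_sum_ginv_smul` — metric contractions
  commute with covariant differentiation**: for a field `P` of bilinear maps (with values in any
  normed space), `∂_X Σ g^{kl} P(b_k,b_l) = Σ g^{kl} [∂_X P(b_k,b_l) − P(Γ(X,b_k),b_l) − P(b_k,Γ(X,b_l))]`
  (`∇g⁻¹ = 0`; O'Neill 1983, Ch. 3, p. 86);
* `IsMetricOn.sum_ginv_apply_covRiemAt` — **the once-contracted second Bianchi identity**
  `Σ g^{kl} G((∇_{b_k}R)(Y,b_l)Z, W) = (∇_Z Ric)(W,Y) − (∇_W Ric)(Z,Y)` ("`div Rm = d^∇ Ric`";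
  Topping 2006, proof of Prop. 2.4.1: `g^{bi}∇_b R_{kila} + ∇_l R_{ak} − ∇_a R_{lk} = 0`), and its
  covariant derivative `IsMetricOn.sum_ginv_apply_cov2RiemAt` —
  `Σ g^{kl} G((∇²_{X,b_k}R)(Y,b_l)Z, W) = (∇²_{X,Z} Ric)(W,Y) − (∇²_{X,W} Ric)(Z,Y)`
  ("applying `∇_i`" in the printed proof);
* `lapRiemAt G b x X Y = Σ g^{kl} (∇²_{b_k,b_l} R)(X,Y)` — **the (rough) Laplacian of the curvature
  endomorphism**, `quadRiemAt` — the quadratic expression `R * R` of the printed formula, and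
  **Topping 2006, Prop. 2.4.1 in coordinates**, `IsMetricOn.apply_lapRiemAt`:
  `G((ΔR)(X,Y)Z, W) = −(∇²_{X,Z}Ric)(W,Y) + (∇²_{X,W}Ric)(Z,Y) + (∇²_{Y,Z}Ric)(W,X) − (∇²_{Y,W}Ric)(Z,X)
     − quadRiemAt(X,Y,Z,W) + quadRiemAt(Y,X,Z,W)`,
  from the differentiated Bianchi identity, the Ricci identity for `R` and the two contraction
  lemmas (the printed proof, without normal coordinates).

Here `(∇²_{X,A} Ric)(B,C) = cov₃At G (cov₂At G (ricAt G)) x X A B C`. Everything is proved; the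
file introduces the definitions `lapRiemAt`, `quadRiemAt` (explicit finite sums) and no statement
is assumed.

## References

* P. Topping, *Lectures on the Ricci flow*, LMS Lecture Note Series 325, CUP 2006, §2.4,
  Prop. 2.4.1 and its proof (p. 32), (2.4.1)–(2.4.2). [Topping2006]
* R. S. Hamilton, *Three-manifolds with positive Ricci curvature*, J. Differential Geom. 17
  (1982), §7, Lemma 7.2. [Hamilton1982]
* B. O'Neill, *Semi-Riemannian geometry with applications to relativity*, Academic Press 1983,
  Ch. 3, p. 86 (contraction commutes with covariant derivatives). [ONeill1983]
-/

noncomputable section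

set_option maxSynthPendingDepth 3

open Set Filter ContinuousLinearMap Module
open scoped Topology ContDiff

namespace Literature.Geometry.Lorentzian

namespace MetricCoord

variable {E : Type*} [NormedAddCommGroup E] [NormedSpace ℝ E]

/-! ### Metric contractions commute with covariant differentiation -/

section Contraction

variable {ι : Type*} [Fintype ι] [FiniteDimensional ℝ E] [CompleteSpace E]
  {F : Type*} [AddCommGroup F] [Module ℝ F]
  {G : E → E →L[ℝ] E →L[ℝ] ℝ} {V : Set E} {x : E} (b : Basis ι ℝ E)

omit [FiniteDimensional ℝ E] [CompleteSpace E] in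
/-- `Σ_l bˡ(v) b_l = v`. [folklore] -/
theorem sum_coord_smul (v : E) : ∑ l, b.coord l v • b l = v := by
  conv_rhs => rw [← b.sum_repr v]
  exact Finset.sum_congr rfl fun l _ ↦ by rw [Basis.coord_apply]

omit [CompleteSpace E] in
/-- **`♯♭ = id` in the basis, vector form**: `Σ_l (Σ_d g^{ld} G(v, b_d)) b_l = v`.
[cite: ONeill1983, Ch. 3, p. 60] -/
theorem sum_ginv_apply_smul (hx : (G x).IsInvertible) (v : E) :
    ∑ l, (∑ d, ginv G b x l d * G x v (b d)) • b l = v := by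
  conv_rhs => rw [← sum_coord_smul b v]
  exact Finset.sum_congr rfl fun l _ ↦ by rw [coord_eq_sum_ginv b hx v l]

omit [CompleteSpace E] in
/-- Contraction of a linear map against `g^{ld} G(v, b_d)`: `Σ_l (Σ_d g^{ld} G(v,b_d)) f(b_l) = f(v)`.
[cite: ONeill1983, Ch. 3, p. 60] -/
theorem sum_ginv_apply_smul_map (hx : (G x).IsInvertible) (f : E →ₗ[ℝ] F) (v : E) :
    ∑ l, (∑ d, ginv G b x l d * G x v (b d)) • f (b l) = f v := by
  conv_rhs => rw [← sum_ginv_apply_smul b hx v]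
  rw [map_sum]
  exact Finset.sum_congr rfl fun l _ ↦ by rw [map_smul]

/-- **Derivative of the inverse metric coefficients**:
`∂_X g^{kl} = −Σ_{cd} g^{kc} (∂_X G)(b_c, b_d) g^{dl}` (from `∂_X ♯ = −♯ ∘ ∂_X G ∘ ♯`).
[cite: ONeill1983, Ch. 3, p. 86] -/
theorem IsMetricOn.fderiv_ginv (hG : IsMetricOn G V) (hx : x ∈ V) (k l : ι) (X : E) :
    fderiv ℝ (fun y ↦ ginv G b y k l) x X =
      -∑ c, ∑ d, ginv G b x k c * fderiv ℝ G x X (b c) (b d) * ginv G b x d l := by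
  -- chain rule for `y ↦ bᵏ(♯_y bˡ)`
  have h1 : HasFDerivAt (fun y ↦ sharpAt G y (coordCLM b l))
      ((fderiv ℝ (sharpAt G) x).flip (coordCLM b l)) x :=
    hasFDerivAt_clm_apply_const (hG.differentiableAt_sharpAt hx).hasFDerivAt (coordCLM b l)
  have h2 := (coordCLM b k).hasFDerivAt.comp x h1
  have hval : fderiv ℝ (fun y ↦ ginv G b y k l) x X =
      b.coord k (fderiv ℝ (sharpAt G) x X (coordCLM b l)) := by
    have : (fun y ↦ ginv G b y k l) = (coordCLM b k) ∘ fun y ↦ sharpAt G y (coordCLM b l) := by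
      funext y; rfl
    rw [this, h2.fderiv]
    rfl
  -- `♯ bˡ = Σ_d g^{dl} b_d`
  have hsharp : sharpAt G x (coordCLM b l) = ∑ d, ginv G b x d l • b d := by
    conv_lhs => rw [← sum_coord_smul b (sharpAt G x (coordCLM b l))]
    rfl
  rw [hval, hG.fderiv_sharpAt hx X, _root_.neg_apply, map_neg,
    ContinuousLinearMap.comp_apply, ContinuousLinearMap.comp_apply, coord_sharpAt_eq_sum b]
  congr 1
  refine Finset.sum_congr rfl fun c _ ↦ ?_
  rw [hsharp, map_sum, _root_.sum_apply, Finset.mul_sum]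
  refine Finset.sum_congr rfl fun d _ ↦ ?_
  rw [map_smul, _root_.smul_apply, smul_eq_mul, hG.fderiv_symm hx X (b d) (b c)]
  ring

/-- **The derivative of the inverse metric contracted against a bilinear map**:
`Σ_{kl} (∂_X g^{kl}) Q(b_k,b_l) = −Σ_{kl} g^{kl} [Q(Γ(X,b_k), b_l) + Q(b_k, Γ(X,b_l))]`
(metric compatibility `∂_X G(v,w) = G(Γ_X v, w) + G(v, Γ_X w)` and `♯♭ = id`).
[cite: ONeill1983, Ch. 3, p. 86] -/
theorem IsMetricOn.sum_fderiv_ginv_smul (hG : IsMetricOn G V) (hx : x ∈ V)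
    (Q : E →ₗ[ℝ] E →ₗ[ℝ] F) (X : E) :
    ∑ k, ∑ l, fderiv ℝ (fun y ↦ ginv G b y k l) x X • Q (b k) (b l) =
      -∑ k, ∑ l, ginv G b x k l • (Q (chrAt G x X (b k)) (b l) + Q (b k) (chrAt G x X (b l))) := by
  have hi := hG.isInvertible x hx
  have hs := hG.symm x hx
  have hgs : ∀ i j, ginv G b x i j = ginv G b x j i := fun i j ↦ ginv_comm b hi hs i j
  set g := ginv G b x with hg
  set Γ := chrAt G x X with hΓ
  -- the two halves of `∂_X G = G(Γ ·, ·) + G(·, Γ ·)`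
  have hA : ∀ k, ∑ l, (∑ c, ∑ d, g k c * G x (Γ (b c)) (b d) * g d l) • Q (b k) (b l)
      = ∑ c, g k c • Q (b k) (Γ (b c)) := by
    intro k
    calc ∑ l, (∑ c, ∑ d, g k c * G x (Γ (b c)) (b d) * g d l) • Q (b k) (b l)
        = ∑ l, ∑ c, g k c • ((∑ d, g l d * G x (Γ (b c)) (b d)) • Q (b k) (b l)) := by
          refine Finset.sum_congr rfl fun l _ ↦ ?_
          rw [Finset.sum_smul]
          refine Finset.sum_congr rfl fun c _ ↦ ?_
          rw [smul_smul, Finset.mul_sum]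
          congr 1
          exact Finset.sum_congr rfl fun d _ ↦ by rw [hgs d l]; ring
      _ = ∑ c, g k c • ∑ l, (∑ d, g l d * G x (Γ (b c)) (b d)) • Q (b k) (b l) := by
          rw [Finset.sum_comm]; simp only [Finset.smul_sum]
      _ = ∑ c, g k c • Q (b k) (Γ (b c)) := by
          refine Finset.sum_congr rfl fun c _ ↦ ?_
          rw [sum_ginv_apply_smul_map b hi (Q (b k)) (Γ (b c))]
  have hB : ∀ l, ∑ k, (∑ c, ∑ d, g k c * G x (b c) (Γ (b d)) * g d l) • Q (b k) (b l)
      = ∑ d, g d l • Q (Γ (b d)) (b l) := by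
    intro l
    calc ∑ k, (∑ c, ∑ d, g k c * G x (b c) (Γ (b d)) * g d l) • Q (b k) (b l)
        = ∑ k, ∑ d, g d l • ((∑ c, g k c * G x (Γ (b d)) (b c)) • Q (b k) (b l)) := by
          refine Finset.sum_congr rfl fun k _ ↦ ?_
          rw [Finset.sum_comm, Finset.sum_smul]
          refine Finset.sum_congr rfl fun d _ ↦ ?_
          rw [smul_smul, Finset.mul_sum]
          congr 1
          exact Finset.sum_congr rfl fun c _ ↦ by rw [hs (b c)]; ring
      _ = ∑ d, g d l • ∑ k, (∑ c, g k c * G x (Γ (b d)) (b c)) • Q (b k) (b l) := by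
          rw [Finset.sum_comm]; simp only [Finset.smul_sum]
      _ = ∑ d, g d l • Q (Γ (b d)) (b l) := by
          refine Finset.sum_congr rfl fun d _ ↦ ?_
          have h := sum_ginv_apply_smul_map b hi (Q.flip (b l)) (Γ (b d))
          simp only [LinearMap.flip_apply] at h
          rw [h]
  -- assemble
  calc ∑ k, ∑ l, fderiv ℝ (fun y ↦ ginv G b y k l) x X • Q (b k) (b l)
      = ∑ k, ∑ l, (-(∑ c, ∑ d, g k c * G x (Γ (b c)) (b d) * g d l)
          - (∑ c, ∑ d, g k c * G x (b c) (Γ (b d)) * g d l)) • Q (b k) (b l) := by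
        refine Finset.sum_congr rfl fun k _ ↦ Finset.sum_congr rfl fun l _ ↦ ?_
        rw [hG.fderiv_ginv b hx]
        congr 1
        simp only [hG.fderiv_eq_chrAt hx X, mul_add, add_mul, Finset.sum_add_distrib, hg, hΓ]
        ring
    _ = -(∑ k, ∑ l, (∑ c, ∑ d, g k c * G x (Γ (b c)) (b d) * g d l) • Q (b k) (b l))
        - ∑ k, ∑ l, (∑ c, ∑ d, g k c * G x (b c) (Γ (b d)) * g d l) • Q (b k) (b l) := by
        simp only [sub_smul, neg_smul, Finset.sum_sub_distrib, Finset.sum_neg_distrib]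
    _ = -(∑ k, ∑ c, g k c • Q (b k) (Γ (b c))) - ∑ l, ∑ d, g d l • Q (Γ (b d)) (b l) := by
        rw [Finset.sum_comm (f := fun k l ↦
          (∑ c, ∑ d, g k c * G x (b c) (Γ (b d)) * g d l) • Q (b k) (b l))]
        simp only [hA, hB]
    _ = _ := by
        rw [Finset.sum_comm (f := fun l d ↦ g d l • Q (Γ (b d)) (b l))]
        simp only [smul_add, Finset.sum_add_distrib, neg_add, hg, hΓ]
        abel

/-- **Metric contractions commute with covariant differentiation**: for a field
`P : E → (E →ₗ E →ₗ F)` of bilinear maps (values in any real vector space `F`, e.g. `ℝ` or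
`End E`) whose components `y ↦ P_y(b_k, b_l)` are differentiable at `x`,
`∂_X (Σ_{kl} g^{kl} P(b_k,b_l)) = Σ_{kl} g^{kl} [∂_X P(b_k,b_l) − P(Γ(X,b_k),b_l) − P(b_k,Γ(X,b_l))]`,
i.e. `∇_X (g^{kl} P_{kl}) = g^{kl} P_{kl;X}` (`∇ g⁻¹ = 0`; O'Neill 1983, Ch. 3, p. 86).
[cite: ONeill1983, Ch. 3, p. 86] -/
theorem IsMetricOn.fderiv_sum_ginv_smul {F : Type*} [NormedAddCommGroup F] [NormedSpace ℝ F]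
    (hG : IsMetricOn G V) (hx : x ∈ V) {P : E → E →ₗ[ℝ] E →ₗ[ℝ] F}
    (hP : ∀ k l, DifferentiableAt ℝ (fun y ↦ P y (b k) (b l)) x) (X : E) :
    fderiv ℝ (fun y ↦ ∑ k, ∑ l, ginv G b y k l • P y (b k) (b l)) x X =
      ∑ k, ∑ l, ginv G b x k l • (fderiv ℝ (fun y ↦ P y (b k) (b l)) x X
        - P x (chrAt G x X (b k)) (b l) - P x (b k) (chrAt G x X (b l))) := by
  have hg : ∀ k l, DifferentiableAt ℝ (fun y ↦ ginv G b y k l) x := fun k l ↦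
    ((hG.contDiffOn_ginv b k l x hx).contDiffAt (hG.mem_nhds hx)).differentiableAt (by simp)
  have hprod : ∀ k l, HasFDerivAt (fun y ↦ ginv G b y k l • P y (b k) (b l))
      ((ginv G b x k l) • fderiv ℝ (fun y ↦ P y (b k) (b l)) x
        + (fderiv ℝ (fun y ↦ ginv G b y k l) x).smulRight (P x (b k) (b l))) x := fun k l ↦
    (hg k l).hasFDerivAt.smul (hP k l).hasFDerivAt
  have hsum : HasFDerivAt (fun y ↦ ∑ k, ∑ l, ginv G b y k l • P y (b k) (b l))
      (∑ k, ∑ l, ((ginv G b x k l) • fderiv ℝ (fun y ↦ P y (b k) (b l)) x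
        + (fderiv ℝ (fun y ↦ ginv G b y k l) x).smulRight (P x (b k) (b l)))) x :=
    HasFDerivAt.fun_sum fun k _ ↦ HasFDerivAt.fun_sum fun l _ ↦ hprod k l
  rw [hsum.fderiv]
  simp only [_root_.sum_apply, _root_.add_apply, _root_.smul_apply,
    ContinuousLinearMap.smulRight_apply, Finset.sum_add_distrib]
  have key := hG.sum_fderiv_ginv_smul b hx (P x) X
  rw [key]
  simp only [smul_sub, smul_add, Finset.sum_sub_distrib, Finset.sum_add_distrib, neg_add]
  abel

end Contraction

/-! ### `∇R` bundled in its derivative and endomorphism slots -/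

section CovRiemCLM

variable (G : E → E →L[ℝ] E →L[ℝ] ℝ)

/-- `(U, V) ↦ (∇_U R)(Y, V)` bundled as a continuous bilinear map into `End E`, written with the
bundled curvature: `DR(U)(Y,V) + Γ_U R(Y,V) − R(Y,V) Γ_U − R(Γ(U,Y),V) − R(Y,Γ(U,V))`
(`= covRiemAt G x U Y V` on `V`, `IsMetricOn.covRiemCLM_apply`). [cite: ONeill1983, Ch. 3, Prop. 3.37] -/
def covRiemCLM (x Y : E) : E →L[ℝ] E →L[ℝ] E →L[ℝ] E :=
  (fderiv ℝ (riemCLM G) x).flip Y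
    + (ContinuousLinearMap.compL ℝ E E E).bilinearComp (chrAt G x) (riemCLM G x Y)
    - (ContinuousLinearMap.compL ℝ E E E).flip.bilinearComp (chrAt G x) (riemCLM G x Y)
    - (riemCLM G x).comp ((chrAt G x).flip Y)
    - (ContinuousLinearMap.compL ℝ E E (E →L[ℝ] E) (riemCLM G x Y)).comp (chrAt G x)

/-- Unfolding lemma for `covRiemCLM`. [folklore] -/
theorem covRiemCLM_apply' (x Y U W : E) :
    covRiemCLM G x Y U W = fderiv ℝ (riemCLM G) x U Y W
      + (chrAt G x U).comp (riemCLM G x Y W) - (riemCLM G x Y W).comp (chrAt G x U)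
      - riemCLM G x (chrAt G x U Y) W - riemCLM G x Y (chrAt G x U W) := by
  simp only [covRiemCLM, _root_.add_apply, _root_.sub_apply, flip_apply,
    ContinuousLinearMap.bilinearComp_apply, ContinuousLinearMap.compL_apply,
    ContinuousLinearMap.comp_apply]

variable {G} {V : Set E} {x : E} [CompleteSpace E]

/-- On `V`, `covRiemCLM G x Y U W = (∇_U R)(Y, W)`. [cite: ONeill1983, Ch. 3, Prop. 3.37] -/
theorem IsMetricOn.covRiemCLM_apply (hG : IsMetricOn G V) (hx : x ∈ V) (Y U W : E) :
    covRiemCLM G x Y U W = covRiemAt G x U Y W := by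
  rw [covRiemCLM_apply', hG.covRiemAt_eq_riemCLM hx U Y W]

/-- `y ↦ G(( ∇_U R)(Y,V')Z, W)` is differentiable at the points of `V`. [folklore] -/
theorem IsMetricOn.differentiableAt_apply_covRiemAt (hG : IsMetricOn G V) (hx : x ∈ V)
    (U Y V' Z W : E) : DifferentiableAt ℝ (fun y ↦ G y (covRiemAt G y U Y V' Z) W) x := by
  have hc : DifferentiableAt ℝ (fun y ↦ covRiemAt G y U Y V' Z) x :=
    differentiableAt_clm_apply_const (hG.differentiableAt_covRiemAt hx U Y V') Z
  exact differentiableAt_clm_apply_const ((hG.differentiableAt hx).clm_apply hc) W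

end CovRiemCLM

/-! ### The once-contracted Bianchi identity and its covariant derivative -/

section ContractedBianchi

variable {ι : Type*} [Fintype ι] [FiniteDimensional ℝ E] [CompleteSpace E]
  {G : E → E →L[ℝ] E →L[ℝ] ℝ} {V : Set E} {x : E} (b : Basis ι ℝ E)

/-- **The once-contracted second Bianchi identity** ("`div Rm = d^∇ Ric`"; Topping 2006, proof
of Prop. 2.4.1: tracing `∇_b R_{laki} + ∇_l R_{abki} + ∇_a R_{blki} = 0` gives
`g^{bi}∇_b R_{kila} + ∇_l R_{ak} − ∇_a R_{lk} = 0`): in any basis,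
`Σ_{kl} g^{kl} G((∇_{b_k}R)(Y,b_l)Z, W) = (∇_Z Ric)(W,Y) − (∇_W Ric)(Z,Y)`.
Proof: pair symmetry of `∇R`, `Σ_l g^{kl} G(v,b_l) = bᵏ(v)`, the second Bianchi identity and
`tr ∘ ∇R = ∇Ric` (`sum_coord_covRiemAt`). [cite: Topping2006, Prop. 2.4.1 (proof)] -/
theorem IsMetricOn.sum_ginv_apply_covRiemAt (hG : IsMetricOn G V) (hx : x ∈ V) (Y Z W : E) :
    ∑ k, ∑ l, ginv G b x k l * G x (covRiemAt G x (b k) Y (b l) Z) W =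
      cov₂At G (ricAt G) x Z W Y - cov₂At G (ricAt G) x W Z Y := by
  have hi := hG.isInvertible x hx
  -- `Σ_l g^{kl} G((∇_k R)(Y,b_l)Z, W) = bᵏ((∇_k R)(Z,W)Y)`
  have h1 : ∀ k, ∑ l, ginv G b x k l * G x (covRiemAt G x (b k) Y (b l) Z) W =
      b.coord k (covRiemAt G x (b k) Z W Y) := by
    intro k
    rw [coord_eq_sum_ginv b hi]
    refine Finset.sum_congr rfl fun l _ ↦ ?_
    rw [hG.apply_covRiemAt_pair_comm hx (b k) Y (b l) Z W]
  simp only [h1]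
  -- second Bianchi: `(∇_k R)(Z,W) = −(∇_Z R)(W,k) − (∇_W R)(k,Z)`
  have h2 : ∀ k, covRiemAt G x (b k) Z W = covRiemAt G x Z (b k) W - covRiemAt G x W (b k) Z := by
    intro k
    have hc := hG.covRiemAt_cyclic hx (b k) Z W
    rw [covRiemAt_swap x Z (b k) W] at hc
    -- `c k Z W + (-c Z k W) + c W k Z = 0`
    have : covRiemAt G x (b k) Z W = -(-covRiemAt G x Z (b k) W) - covRiemAt G x W (b k) Z :=
      by rw [← sub_eq_zero]; rw [← hc]; abel
    rw [this, neg_neg]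
  simp only [h2, _root_.sub_apply, map_sub, Finset.sum_sub_distrib, hG.sum_coord_covRiemAt b hx]

/-- **The covariant derivative of the once-contracted Bianchi identity** (Topping 2006, proof
of Prop. 2.4.1: "Applying `∇_i` … we see that `∇_j∇_i R_{kila} = ∇_j∇_a R_{lk} − ∇_j∇_l R_{ak}`"):
`Σ_{kl} g^{kl} G((∇²_{X,b_k}R)(Y,b_l)Z, W) = (∇²_{X,Z} Ric)(W,Y) − (∇²_{X,W} Ric)(Z,Y)`, with
`(∇²_{X,A} Ric)(B,C) = cov₃At G (cov₂At G Ric) x X A B C`. Proof: differentiate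
`sum_ginv_apply_covRiemAt` (valid near `x`) along `X`; the contraction commutes with `∇_X`
(`fderiv_sum_ginv_smul`), lowering commutes with `∇_X` (`apply_cov2RiemAt`), and the remaining
Christoffel corrections are again instances of the contracted identity.
[cite: Topping2006, Prop. 2.4.1 (proof)] -/
theorem IsMetricOn.sum_ginv_apply_cov2RiemAt (hG : IsMetricOn G V) (hx : x ∈ V) (X Y Z W : E) :
    ∑ k, ∑ l, ginv G b x k l * G x (cov2RiemAt G x X (b k) Y (b l) Z) W =
      cov₃At G (cov₂At G (ricAt G)) x X Z W Y - cov₃At G (cov₂At G (ricAt G)) x X W Z Y := by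
  -- the field of bilinear maps `P_y(U,V') = G_y((∇_U R)_y(Y,V')Z, W)`
  set P : E → E →ₗ[ℝ] E →ₗ[ℝ] ℝ := fun y ↦ LinearMap.mk₂ ℝ
    (fun U V' ↦ G y (covRiemCLM G y Y U V' Z) W)
    (fun U₁ U₂ V' ↦ by simp only [map_add, _root_.add_apply])
    (fun c U V' ↦ by simp only [map_smul, _root_.smul_apply, smul_eq_mul])
    (fun U V₁ V₂ ↦ by simp only [map_add, _root_.add_apply])
    (fun c U V' ↦ by simp only [map_smul, _root_.smul_apply, smul_eq_mul]) with hPdef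
  have hPV : ∀ y ∈ V, ∀ U V' : E, P y U V' = G y (covRiemAt G y U Y V' Z) W := fun y hy U V' ↦ by
    simp only [hPdef, LinearMap.mk₂_apply, hG.covRiemCLM_apply hy]
  have hPeq : ∀ U V' : E, (fun y ↦ P y U V') =ᶠ[𝓝 x] fun y ↦ G y (covRiemAt G y U Y V' Z) W :=
    fun U V' ↦ (hG.eventually_mem hx).mono fun y hy ↦ hPV y hy U V'
  have hP : ∀ k l, DifferentiableAt ℝ (fun y ↦ P y (b k) (b l)) x := fun k l ↦
    (hG.differentiableAt_apply_covRiemAt hx (b k) Y (b l) Z W).congr_of_eventuallyEq (hPeq (b k) (b l))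
  -- the contracted function and the contracted Bianchi identity near `x`
  set c : E → E →L[ℝ] E →L[ℝ] E →L[ℝ] ℝ := cov₂At G (ricAt G) with hcdef
  have hD : (fun y ↦ ∑ k, ∑ l, ginv G b y k l • P y (b k) (b l)) =ᶠ[𝓝 x]
      fun y ↦ c y Z W Y - c y W Z Y :=
    (hG.eventually_mem hx).mono fun y hy ↦ by
      simp only [smul_eq_mul, hPV y hy, hG.sum_ginv_apply_covRiemAt b hy, hcdef]
  -- differentiate both sides along `X`
  have hc : DifferentiableAt ℝ c x :=
    hG.differentiableAt_cov₂At hx (hG.contDiffAt_ricAt hx)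
  have hc1 : ∀ A B C : E, DifferentiableAt ℝ (fun y ↦ c y A B C) x := fun A B C ↦
    differentiableAt_clm_apply_const (differentiableAt_clm_apply_const
      (differentiableAt_clm_apply_const hc A) B) C
  have hcev : ∀ A B C : E, fderiv ℝ (fun y ↦ c y A B C) x X = fderiv ℝ c x X A B C := by
    intro A B C
    have h1 : DifferentiableAt ℝ (fun y ↦ c y A) x := differentiableAt_clm_apply_const hc A
    have h2 : DifferentiableAt ℝ (fun y ↦ c y A B) x := differentiableAt_clm_apply_const h1 B
    rw [fderiv_clm_apply_const h2 C X, fderiv_clm_apply_const h1 B X, fderiv_clm_apply_const hc A X]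
  have hRHS : fderiv ℝ (fun y ↦ ∑ k, ∑ l, ginv G b y k l • P y (b k) (b l)) x X =
      fderiv ℝ c x X Z W Y - fderiv ℝ c x X W Z Y := by
    rw [hD.fderiv_eq, fderiv_fun_sub (hc1 Z W Y) (hc1 W Z Y), _root_.sub_apply, hcev, hcev]
  have hLHS := hG.fderiv_sum_ginv_smul b hx hP X
  -- the derivative of the components of `P`
  have hdP : ∀ k l, fderiv ℝ (fun y ↦ P y (b k) (b l)) x X =
      G x (cov2RiemAt G x X (b k) Y (b l) Z) W
        + G x (covRiemAt G x (chrAt G x X (b k)) Y (b l) Z) W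
        + G x (covRiemAt G x (b k) (chrAt G x X Y) (b l) Z) W
        + G x (covRiemAt G x (b k) Y (chrAt G x X (b l)) Z) W
        + G x (covRiemAt G x (b k) Y (b l) (chrAt G x X Z)) W
        + G x (covRiemAt G x (b k) Y (b l) Z) (chrAt G x X W) := by
    intro k l
    rw [(hPeq (b k) (b l)).fderiv_eq, hG.apply_cov2RiemAt hx]
    ring
  -- three further instances of the contracted identity
  have e1 := hG.sum_ginv_apply_covRiemAt b hx (chrAt G x X Y) Z W
  have e2 := hG.sum_ginv_apply_covRiemAt b hx Y (chrAt G x X Z) W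
  have e3 := hG.sum_ginv_apply_covRiemAt b hx Y Z (chrAt G x X W)
  rw [hRHS] at hLHS
  simp only [smul_eq_mul, hdP, hPV x hx] at hLHS
  simp only [mul_add, mul_sub, Finset.sum_add_distrib, Finset.sum_sub_distrib, e1, e2, e3,
    ← hcdef] at hLHS
  simp only [cov₃At_apply]
  linarith

end ContractedBianchi

/-! ### The Laplacian of the curvature endomorphism (Topping 2006, Prop. 2.4.1) -/

section Laplacian

variable {ι : Type*} [Fintype ι] [FiniteDimensional ℝ E] (G : E → E →L[ℝ] E →L[ℝ] ℝ)
  (b : Basis ι ℝ E)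

/-- The **rough Laplacian of the curvature endomorphism** in a basis:
`(ΔR)_x(X,Y) = Σ_{kl} g^{kl} (∇²_{b_k,b_l} R)(X,Y) ∈ End E` (Topping 2006, §2.1: `Δ = tr₁₂ ∇²`,
here on the `(1,3)` tensor `R`; (2.4.1)). [cite: Topping2006, §2.4, (2.4.1)] -/
def lapRiemAt (x X Y : E) : E →L[ℝ] E :=
  ∑ k, ∑ l, ginv G b x k l • cov2RiemAt G x (b k) (b l) X Y

/-- The **quadratic curvature expression** of the Laplacian formula in a basis:
`Q_x(X,Y,Z,W) = Σ_{kl} g^{kl} G(([R(b_k,X), R(Y,b_l)] − R(R(b_k,X)Y, b_l) − R(Y, R(b_k,X)b_l)) Z, W)`,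
the lowered right-hand side of the Ricci identity for `R` (`cov2RiemAt_comm`) contracted over
`(b_k, b_l)` — Topping's `R_{jc}R_{kcla} + B_{jkla} − B_{jkal} + B_{jlka} − B_{jakl}` of (2.4.2)
in the tree's conventions, i.e. an instance of `Rm * Rm`. [cite: Topping2006, §2.4, (2.4.2)] -/
def quadRiemAt (x X Y Z W : E) : ℝ :=
  ∑ k, ∑ l, ginv G b x k l * G x (((riemAt G x (b k) X).comp (riemAt G x Y (b l))
    - (riemAt G x Y (b l)).comp (riemAt G x (b k) X)
    - riemAt G x (riemAt G x (b k) X Y) (b l) - riemAt G x Y (riemAt G x (b k) X (b l))) Z) W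

variable {G} {V : Set E} {x : E} [CompleteSpace E]

/-- **Topping 2006, Prop. 2.4.1 — the Laplacian of the curvature tensor, in coordinates.** For
metric components smooth, symmetric and nondegenerate near `x`, in any basis `b`:
`G((ΔR)(X,Y)Z, W) = −(∇²_{X,Z}Ric)(W,Y) + (∇²_{X,W}Ric)(Z,Y) + (∇²_{Y,Z}Ric)(W,X) − (∇²_{Y,W}Ric)(Z,X)
   − Q(X,Y,Z,W) + Q(Y,X,Z,W)`,
where `ΔR = lapRiemAt`, `(∇²_{X,A}Ric)(B,C) = cov₃At G (cov₂At G Ric) x X A B C` and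
`Q = quadRiemAt` is the quadratic term (`Rm * Rm`). This is the printed statement
`ΔR_{jkla} = −∇_j∇_a R_{lk} + ∇_j∇_l R_{ak} + ∇_k∇_a R_{lj} − ∇_k∇_l R_{aj} + Rm * Rm` in the tree's
conventions (our `R(X,Y)` is Topping's `−R(X,Y)`), proved as printed but without normal
coordinates: the differentiated Bianchi identity (`cov2RiemAt_cyclic`), the Ricci identity for
`R` (`cov2RiemAt_comm`) and the differentiated contracted Bianchi identity
(`sum_ginv_apply_cov2RiemAt`). [cite: Topping2006, Prop. 2.4.1] -/
theorem IsMetricOn.apply_lapRiemAt (hG : IsMetricOn G V) (hx : x ∈ V) (X Y Z W : E) :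
    G x (lapRiemAt G b x X Y Z) W =
      -(cov₃At G (cov₂At G (ricAt G)) x X Z W Y - cov₃At G (cov₂At G (ricAt G)) x X W Z Y)
      + (cov₃At G (cov₂At G (ricAt G)) x Y Z W X - cov₃At G (cov₂At G (ricAt G)) x Y W Z X)
      - quadRiemAt G b x X Y Z W + quadRiemAt G b x Y X Z W := by
  -- `(∇²_{k,l}R)(X,Y) = −(∇²_{k,X}R)(Y,l) + (∇²_{k,Y}R)(X,l)` and the Ricci identity
  have hstep : ∀ k l, cov2RiemAt G x (b k) (b l) X Y =
      -(cov2RiemAt G x X (b k) Y (b l) + ((riemAt G x (b k) X).comp (riemAt G x Y (b l))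
        - (riemAt G x Y (b l)).comp (riemAt G x (b k) X)
        - riemAt G x (riemAt G x (b k) X Y) (b l) - riemAt G x Y (riemAt G x (b k) X (b l))))
      + (cov2RiemAt G x Y (b k) X (b l) + ((riemAt G x (b k) Y).comp (riemAt G x X (b l))
        - (riemAt G x X (b l)).comp (riemAt G x (b k) Y)
        - riemAt G x (riemAt G x (b k) Y X) (b l) - riemAt G x X (riemAt G x (b k) Y (b l)))) := by
    intro k l
    have hcyc := hG.cov2RiemAt_cyclic hx (b k) (b l) X Y
    have hX := hG.cov2RiemAt_comm hx (b k) X Y (b l)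
    have hY := hG.cov2RiemAt_comm hx (b k) Y X (b l)
    rw [cov2RiemAt_swap x (b k) Y X (b l)] at hcyc
    rw [← sub_eq_zero]
    rw [← sub_eq_zero] at hX hY
    rw [← hcyc]
    -- linear combination in the additive group `End E`
    have : cov2RiemAt G x (b k) (b l) X Y -
        (-(cov2RiemAt G x X (b k) Y (b l) + ((riemAt G x (b k) X).comp (riemAt G x Y (b l))
          - (riemAt G x Y (b l)).comp (riemAt G x (b k) X)
          - riemAt G x (riemAt G x (b k) X Y) (b l) - riemAt G x Y (riemAt G x (b k) X (b l))))
        + (cov2RiemAt G x Y (b k) X (b l) + ((riemAt G x (b k) Y).comp (riemAt G x X (b l))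
          - (riemAt G x X (b l)).comp (riemAt G x (b k) Y)
          - riemAt G x (riemAt G x (b k) Y X) (b l) - riemAt G x X (riemAt G x (b k) Y (b l)))))
        = (cov2RiemAt G x (b k) (b l) X Y + cov2RiemAt G x (b k) X Y (b l)
            + -cov2RiemAt G x (b k) Y X (b l))
          - (cov2RiemAt G x (b k) X Y (b l) - cov2RiemAt G x X (b k) Y (b l)
            - ((riemAt G x (b k) X).comp (riemAt G x Y (b l))
              - (riemAt G x Y (b l)).comp (riemAt G x (b k) X)
              - riemAt G x (riemAt G x (b k) X Y) (b l) - riemAt G x Y (riemAt G x (b k) X (b l))))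
          + (cov2RiemAt G x (b k) Y X (b l) - cov2RiemAt G x Y (b k) X (b l)
            - ((riemAt G x (b k) Y).comp (riemAt G x X (b l))
              - (riemAt G x X (b l)).comp (riemAt G x (b k) Y)
              - riemAt G x (riemAt G x (b k) Y X) (b l) - riemAt G x X (riemAt G x (b k) Y (b l)))) := by
      abel
    rw [this, hX, hY]
    abel
  -- contract
  unfold lapRiemAt
  simp only [_root_.sum_apply, _root_.smul_apply, map_sum, map_smul, smul_eq_mul, hstep,
    _root_.add_apply, _root_.neg_apply, map_add, map_neg, mul_add, mul_neg,
    Finset.sum_add_distrib, Finset.sum_neg_distrib, hG.sum_ginv_apply_cov2RiemAt b hx]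
  unfold quadRiemAt
  ring

end Laplacian

/-! ### Symmetry of `∇² Ric` in its last two slots -/

section Symm

variable [FiniteDimensional ℝ E] [CompleteSpace E] {G : E → E →L[ℝ] E →L[ℝ] ℝ} {V : Set E} {x : E}

omit [FiniteDimensional ℝ E] [CompleteSpace E] in
/-- The covariant derivative of a field of trilinear forms symmetric in their last two slots is
symmetric in its last two slots. [folklore] -/
theorem cov₃At_symm₂₃ {τ : E → E →L[ℝ] E →L[ℝ] E →L[ℝ] ℝ} (hτ : DifferentiableAt ℝ τ x)
    (hs : ∀ᶠ y in 𝓝 x, ∀ A B C, τ y A B C = τ y A C B) (W A B C : E) :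
    cov₃At G τ x W A B C = cov₃At G τ x W A C B := by
  simp only [cov₃At_apply]
  have h1 : fderiv ℝ τ x W A B C = fderiv ℝ τ x W A C B := by
    have hA : DifferentiableAt ℝ (fun y ↦ τ y A) x := differentiableAt_clm_apply_const hτ A
    rw [← fderiv_clm_apply_const hτ A W, ← fderiv_clm_apply_const hA B W,
      ← fderiv_clm_apply_const hA C W,
      ← fderiv_clm_apply_const (differentiableAt_clm_apply_const hA B) C W,
      ← fderiv_clm_apply_const (differentiableAt_clm_apply_const hA C) B W]
    have heq : (fun y ↦ τ y A B C) =ᶠ[𝓝 x] fun y ↦ τ y A C B := hs.mono fun y hy ↦ hy A B C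
    rw [heq.fderiv_eq]
  rw [h1, hs.self_of_nhds (chrAt G x W A) B C, hs.self_of_nhds A (chrAt G x W B) C,
    hs.self_of_nhds A B (chrAt G x W C)]
  ring

/-- **`∇² Ric` is symmetric in its last two slots**:
`(∇²_{X,A} Ric)(B,C) = (∇²_{X,A} Ric)(C,B)` (`Ric` is symmetric). [cite: ONeill1983, Ch. 3, Lemma 3.52] -/
theorem IsMetricOn.cov₃At_cov₂At_ricAt_symm (hG : IsMetricOn G V) (hx : x ∈ V) (X A B C : E) :
    cov₃At G (cov₂At G (ricAt G)) x X A B C = cov₃At G (cov₂At G (ricAt G)) x X A C B := by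
  refine cov₃At_symm₂₃ (hG.differentiableAt_cov₂At hx (hG.contDiffAt_ricAt hx)) ?_ X A B C
  refine (hG.eventually_mem hx).mono fun y hy A' B' C' ↦ ?_
  exact cov₂At_symm (hG.differentiableAt_ricAt hy)
    ((hG.eventually_mem hy).mono fun z hz v w ↦ hG.ricAt_comm hz v w) A' B' C'

end Symm

end MetricCoord

end Literature.Geometry.Lorentzian

end
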